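import Literature.AlgebraicGeometry.Frobenioids.ModelFrobenioidPreFrobenioid
import Literature.AlgebraicGeometry.Frobenioids.ModelFrobenioidBirational
import HarnessLib

/-!
# Frobenioids I, Theorem 5.2 (ii) for the model Frobenioid: pre-steps, isomorphisms with prescribed
# zero divisor, units, and the fraction `s' · (s'')⁻¹` under composition

Mochizuki, *The geometry of Frobenioids I: the general theory*, Kyushu J. Math. **62** (2008),
§5, Theorem 5.2 (i)–(ii), kurims text pp. 100–101 [cite: MochizukiFrdI2008, Thm. 5.2(ii) p.101];
the properties established are those of Definition 1.3 (iii)(d) ("pre-steps out of an object are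
classified, up to isomorphism, by their zero divisors") and (v) (total epimorphicity; pre-steps are
monomorphisms) specialised to the EXPLICIT category `C = ModelFrobenioid Φ B DivB` of Thm. 5.2 (i)
(a morphism is the data `(deg_Fr, Base, Div, u)` subject to relation (d)), under the hypotheses of
Thm. 5.2: `Φ` divisorial (objectwise), `B` group-like (objectwise).

Contents (all proved, no new definitions):
* pre-steps composed with isomorphisms are pre-steps; `Div`, `u` of such composites;
* cancellation: a morphism whose `Base` is an isomorphism is an epimorphism of `C`; a LINEAR
  morphism whose `Base` is a monomorphism is a monomorphism of `C` (for Frobenius degree `> 1`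
  right-cancellation fails, cf. `ModelFrobenioidFrobeniusNotMono.lean`);
* existence of isomorphisms: two base-isomorphisms `s : X → Y`, `t : X → Z` of the same Frobenius
  degree with `Div(s) = Div(t)` satisfy `t = v ∘ s` for an isomorphism `v : Y ⥲ Z`; the "left" version
  for linear `s : X → Y`, `t : Z → Y` with `Base(s)⁻¹* Div(s) = Base(t)⁻¹* Div(t)`;
* two isomorphisms with the same `Base` differ by an element of `O^×`; an element of `O^×` with
  trivial rational function `u = 1` is trivial;
* the fraction `s' · (s'')⁻¹ ∈ B(Base X)` (`ModelFrobenioid.frac`) under post-composition with a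
  linear morphism, pre-composition with an arbitrary morphism, and insertion of units; restriction
  `f ↦ f|_Y` (`biratRestrict`) after pre-composition.
These are the [FrdI]-level inputs of [EtTh] Prop. 4.2 (i)(ii) (abc-iut cell, seat abc-iut-L6-t12).
Diagrammatic composition (`φ ≫ ψ` = the paper's `ψ ∘ φ`); monoids written multiplicatively.
-/

noncomputable section

namespace Literature.AlgebraicGeometry.Frobenioids

namespace ModelFrobenioid

open CategoryTheory Opposite
open PreFrobenioid (pull_inv_pull_eq pull_pull_inv_eq pull_injective pullGp_of' pullGp_inv_pullGp
  pullGp_pullGp_inv pullGp_injective)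

universe w v u

variable {D : Type u} [Category.{v} D] {Φ B : Dᵒᵖ ⥤ CommMonCat.{w}} {DivB : B ⟶ monoidGp Φ}
variable {X Y Z : ModelFrobenioid Φ B DivB}

/-! ### Pre-steps and isomorphisms -/

/-- A pre-step followed by an isomorphism is a pre-step ([FrdI] Def. 1.2 (iii): linear base-isomorphism;
isomorphisms are linear base-isomorphisms). [cite: MochizukiFrdI2008, Thm. 5.2(ii) p.101] -/
theorem isPreStep_comp_of_isIso {s : X ⟶ Y} (hs : PreFrobenioid.IsPreStep (toElem Φ B DivB) s)
    (v : Y ⟶ Z) [IsIso v] : PreFrobenioid.IsPreStep (toElem Φ B DivB) (s ≫ v) := by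
  haveI : IsIso (baseMap s) := hs.2
  haveI : IsIso (baseMap v) := isIso_baseMap_of_isIso v
  refine ⟨?_, ?_⟩
  · change degFr (s ≫ v) = 1
    rw [degFr_comp, degFr_eq_one_of_isIso v, one_mul]
    exact hs.1
  · change IsIso (baseMap (s ≫ v))
    rw [baseMap_comp]
    infer_instance

/-- An isomorphism followed by a pre-step is a pre-step. [cite: MochizukiFrdI2008, Thm. 5.2(ii) p.101] -/
theorem isPreStep_comp_of_isIso' (v : X ⟶ Y) [IsIso v] {s : Y ⟶ Z}
    (hs : PreFrobenioid.IsPreStep (toElem Φ B DivB) s) :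
    PreFrobenioid.IsPreStep (toElem Φ B DivB) (v ≫ s) := by
  haveI : IsIso (baseMap s) := hs.2
  haveI : IsIso (baseMap v) := isIso_baseMap_of_isIso v
  refine ⟨?_, ?_⟩
  · change degFr (v ≫ s) = 1
    rw [degFr_comp, degFr_eq_one_of_isIso v, mul_one]
    exact hs.1
  · change IsIso (baseMap (v ≫ s))
    rw [baseMap_comp]
    infer_instance

/-- `Div(v ∘ s) = Div(s)` for an isomorphism `v` (`Φ` divisorial: `Div(v) = 0`, `deg_Fr(v) = 1`).
[cite: MochizukiFrdI2008, Thm. 5.2(ii) p.101] -/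
theorem div_comp_of_isIso (hΦd : Objectwise (fun M _ => IsDivisorial M) Φ) (s : X ⟶ Y) (v : Y ⟶ Z)
    [IsIso v] : div (s ≫ v) = div s := by
  rw [div_comp, div_eq_one_of_isIso hΦd v, map_one, one_mul, degFr_eq_one_of_isIso v, PNat.one_coe,
    pow_one]

/-- `u_{v ∘ s} = Base(s)^* u_v · u_s` for a linear `v`. [cite: MochizukiFrdI2008, Thm. 5.2(i) p.100] -/
theorem unit_comp_of_degFr_eq_one (s : X ⟶ Y) {v : Y ⟶ Z} (hv : degFr v = 1) :
    unit (s ≫ v) = pull B (baseMap s) (unit v) * unit s := by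
  rw [unit_comp_pull, hv, PNat.one_coe, pow_one]

/-- `Div(s ∘ v) = Base(v)^* Div(s)` for an isomorphism `v` (`Φ` divisorial).
[cite: MochizukiFrdI2008, Thm. 5.2(ii) p.101] -/
theorem div_comp_of_isIso' (hΦd : Objectwise (fun M _ => IsDivisorial M) Φ) (v : X ⟶ Y) [IsIso v]
    (s : Y ⟶ Z) : div (v ≫ s) = pull Φ (baseMap v) (div s) := by
  rw [div_comp_pull, div_eq_one_of_isIso hΦd v, one_pow, mul_one]

/-! ### Cancellation: base-isomorphisms are epimorphisms; linear base-monomorphisms are monomorphisms -/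

/-- A morphism `s` of `C` whose `Base(s)` is an isomorphism is an epimorphism: `ψ ∘ s = ψ' ∘ s`
implies `ψ = ψ'` (`Φ(Base X)`, `B(Base X)` cancellative, as they are for `Φ` divisorial, `B`
group-like — the computation behind "`C` is totally epimorphic", [FrdI] Def. 1.3 (v)).
[cite: MochizukiFrdI2008, Thm. 5.2(ii) p.101] -/
theorem cancel_left_of_isIso_baseMap (hΦd : Objectwise (fun M _ => IsDivisorial M) Φ)
    (hBg : Objectwise (fun M _ => IsGroupLike M) B) (s : X ⟶ Y) [IsIso (baseMap s)]
    {ψ ψ' : Y ⟶ Z} (e : s ≫ ψ = s ≫ ψ') : ψ = ψ' := by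
  haveI : IsCancelMul (Φ.obj (op X.base)) :=
    isIntegral_iff_isCancelMul.mp (hΦd X.base).isPreDivisorial.isIntegral
  haveI : IsCancelMul (B.obj (op X.base)) :=
    isIntegral_iff_isCancelMul.mp (hBg X.base).isPreDivisorial.isIntegral
  have hdeg : degFr ψ * degFr s = degFr ψ' * degFr s := congrArg Hom.degFr e
  have hb : baseMap s ≫ baseMap ψ = baseMap s ≫ baseMap ψ' := congrArg Hom.base e
  have hdiv : pull Φ (baseMap s) (div ψ) * div s ^ (degFr ψ : ℕ) =
      pull Φ (baseMap s) (div ψ') * div s ^ (degFr ψ' : ℕ) := congrArg Hom.div e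
  have hun : pull B (baseMap s) (unit ψ) * unit s ^ (degFr ψ : ℕ) =
      pull B (baseMap s) (unit ψ') * unit s ^ (degFr ψ' : ℕ) := congrArg Hom.unit e
  have hdeg' : degFr ψ = degFr ψ' := mul_right_cancel hdeg
  rw [hdeg'] at hdiv hun
  exact hom_ext hdeg' ((cancel_epi (baseMap s)).mp hb) (pull_injective (baseMap s) (mul_right_cancel hdiv))
    (pull_injective (baseMap s) (mul_right_cancel hun))

/-- A LINEAR morphism `s` of `C` whose `Base(s)` is a monomorphism of `D` (e.g. an isomorphism, as
for a pre-step) is a monomorphism: `s ∘ ψ = s ∘ ψ'` implies `ψ = ψ'` ("pre-steps are always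
monomorphisms", [FrdI] Def. 1.3 (v)(a), for the model). [cite: MochizukiFrdI2008, Thm. 5.2(ii) p.101] -/
theorem cancel_right_of_degFr_eq_one (hΦd : Objectwise (fun M _ => IsDivisorial M) Φ)
    (hBg : Objectwise (fun M _ => IsGroupLike M) B) (s : Y ⟶ Z) [Mono (baseMap s)] (hs : degFr s = 1)
    {ψ ψ' : X ⟶ Y} (e : ψ ≫ s = ψ' ≫ s) : ψ = ψ' := by
  haveI : IsCancelMul (Φ.obj (op X.base)) :=
    isIntegral_iff_isCancelMul.mp (hΦd X.base).isPreDivisorial.isIntegral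
  haveI : IsCancelMul (B.obj (op X.base)) :=
    isIntegral_iff_isCancelMul.mp (hBg X.base).isPreDivisorial.isIntegral
  have hdeg : degFr s * degFr ψ = degFr s * degFr ψ' := congrArg Hom.degFr e
  have hb : baseMap ψ ≫ baseMap s = baseMap ψ' ≫ baseMap s := congrArg Hom.base e
  have hdiv : pull Φ (baseMap ψ) (div s) * div ψ ^ (degFr s : ℕ) =
      pull Φ (baseMap ψ') (div s) * div ψ' ^ (degFr s : ℕ) := congrArg Hom.div e
  have hun : pull B (baseMap ψ) (unit s) * unit ψ ^ (degFr s : ℕ) =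
      pull B (baseMap ψ') (unit s) * unit ψ' ^ (degFr s : ℕ) := congrArg Hom.unit e
  have hdeg' : degFr ψ = degFr ψ' := mul_left_cancel hdeg
  have hb' : baseMap ψ = baseMap ψ' := (cancel_mono (baseMap s)).mp hb
  rw [hb', hs, PNat.one_coe, pow_one, pow_one] at hdiv hun
  exact hom_ext hdeg' hb' (mul_left_cancel hdiv) (mul_left_cancel hun)

/-! ### Isomorphisms with prescribed zero divisor ([FrdI] Def. 1.3 (iii)(d) for the model) -/

/-- **Base-isomorphisms out of `X` are classified by `(deg_Fr, Div)` up to a unique isomorphism of the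
target — existence.**  For `s : X → Y`, `t : X → Z` with `Base(s)`, `Base(t)` isomorphisms,
`deg_Fr(s) = deg_Fr(t)` and `Div(s) = Div(t)`, there is an isomorphism `v : Y ⥲ Z` with `t = v ∘ s`
(namely `(1, Base(t) ∘ Base(s)⁻¹, 0, (Base(s)⁻¹)^*(u_t · u_s⁻¹))`; `B` group-like).
[cite: MochizukiFrdI2008, Thm. 5.2(ii) p.101] -/
theorem exists_iso_comp_eq_of_div_eq (hBg : Objectwise (fun M _ => IsGroupLike M) B) (s : X ⟶ Y)
    (t : X ⟶ Z) [IsIso (baseMap s)] [IsIso (baseMap t)] (hdeg : degFr s = degFr t)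
    (hdiv : div s = div t) : ∃ v : Y ≅ Z, s ≫ v.hom = t := by
  obtain ⟨us, hus⟩ := (hBg X.base).isUnit (unit s)
  obtain ⟨ut, hut⟩ := (hBg X.base).isUnit (unit t)
  let f : Y.base ⟶ Z.base := inv (baseMap s) ≫ baseMap t
  let u : B.obj (op Y.base) := pull B (inv (baseMap s)) (↑(ut * us⁻¹))
  have e1 : pullGp Φ (baseMap s) Y.cls * divB Φ B DivB _ (unit s) =
      pullGp Φ (baseMap t) Z.cls * divB Φ B DivB _ (unit t) := by
    rw [← rel s, ← rel t, hdeg, hdiv]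
  have e2 := congrArg (pullGp Φ (inv (baseMap s))) e1
  rw [map_mul, map_mul, pullGp_inv_pullGp, ← pullGp_comp, pullGp_divB_pull, pullGp_divB_pull] at e2
  have hinv : divB Φ B DivB (op Y.base) (pull B (inv (baseMap s)) (↑us⁻¹ : B.obj (op X.base))) =
      (divB Φ B DivB (op Y.base) (pull B (inv (baseMap s)) (unit s)))⁻¹ := by
    apply eq_inv_of_mul_eq_one_right
    rw [← map_mul, ← map_mul, ← hus, Units.mul_inv, map_one, map_one]
  have hrel : Y.cls ^ ((1 : ℕ+) : ℕ) * Algebra.GrothendieckGroup.of 1 =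
      pullGp Φ f Z.cls * divB Φ B DivB (op Y.base) u := by
    rw [PNat.one_coe, pow_one, map_one, mul_one]
    change Y.cls = pullGp Φ f Z.cls *
      divB Φ B DivB (op Y.base) (pull B (inv (baseMap s)) (↑(ut * us⁻¹) : B.obj (op X.base)))
    rw [Units.val_mul, hut, map_mul, map_mul, hinv, ← mul_assoc, ← e2, mul_inv_cancel_right]
  let v₀ : Y ⟶ Z := mkHom Y Z 1 f 1 u hrel
  haveI : IsIso (baseMap v₀) := by
    change IsIso f
    infer_instance
  haveI : IsIso v₀ := isIso_of hBg v₀ rfl rfl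
  refine ⟨asIso v₀, hom_ext ?_ ?_ ?_ ?_⟩
  · change (1 : ℕ+) * degFr s = degFr t
    rw [one_mul, hdeg]
  · change baseMap s ≫ (inv (baseMap s) ≫ baseMap t) = baseMap t
    rw [IsIso.hom_inv_id_assoc]
  · change pull Φ (baseMap s) 1 * div s ^ ((1 : ℕ+) : ℕ) = div t
    rw [map_one, one_mul, PNat.one_coe, pow_one, hdiv]
  · change pull B (baseMap s) (pull B (inv (baseMap s)) (↑(ut * us⁻¹) : B.obj (op X.base))) *
        unit s ^ ((1 : ℕ+) : ℕ) = unit t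
    rw [pull_pull_inv_eq, PNat.one_coe, pow_one, Units.val_mul, ← hus, Units.inv_mul_cancel_right, hut]

/-- **Left version.**  For LINEAR `s : X → Y`, `t : Z → Y` with `Base(s)`, `Base(t)` isomorphisms and
`(Base(s)⁻¹)^* Div(s) = (Base(t)⁻¹)^* Div(t)` in `Φ(Base Y)`, there is an isomorphism `v : Z ⥲ X`
with `t = s ∘ v` (namely `(1, Base(s)⁻¹ ∘ Base(t), 0, u_t · (Base(v)^* u_s)⁻¹)`; `B` group-like).
[cite: MochizukiFrdI2008, Thm. 5.2(ii) p.101] -/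
theorem exists_iso_comp_eq_of_pull_div_eq (hBg : Objectwise (fun M _ => IsGroupLike M) B)
    (s : X ⟶ Y) (t : Z ⟶ Y) [IsIso (baseMap s)] [IsIso (baseMap t)] (hs : degFr s = 1)
    (ht : degFr t = 1)
    (hdiv : pull Φ (inv (baseMap s)) (div s) = pull Φ (inv (baseMap t)) (div t)) :
    ∃ v : Z ≅ X, v.hom ≫ s = t := by
  let g : Z.base ⟶ X.base := baseMap t ≫ inv (baseMap s)
  obtain ⟨w, hw⟩ := (hBg Z.base).isUnit (pull B g (unit s))
  obtain ⟨ut, hut⟩ := (hBg Z.base).isUnit (unit t)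
  let u : B.obj (op Z.base) := ↑(ut * w⁻¹)
  have hdivt : pull Φ g (div s) = div t := by
    change pull Φ (baseMap t ≫ inv (baseMap s)) (div s) = div t
    rw [pull_comp, hdiv, pull_pull_inv_eq]
  have E1 : Z.cls * Algebra.GrothendieckGroup.of (div t) =
      pullGp Φ (baseMap t) Y.cls * divB Φ B DivB _ (unit t) := by
    have h := rel t
    rwa [ht, PNat.one_coe, pow_one] at h
  have E2 : pullGp Φ g X.cls * Algebra.GrothendieckGroup.of (div t) =
      pullGp Φ (baseMap t) Y.cls * divB Φ B DivB _ (pull B g (unit s)) := by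
    have h := congrArg (pullGp Φ g) (rel s)
    rw [hs, PNat.one_coe, pow_one, map_mul, map_mul, pullGp_of', hdivt, ← pullGp_comp,
      pullGp_divB_pull] at h
    have hg : g ≫ baseMap s = baseMap t := by
      change (baseMap t ≫ inv (baseMap s)) ≫ baseMap s = baseMap t
      rw [Category.assoc, IsIso.inv_hom_id, Category.comp_id]
    rwa [hg] at h
  have hinv : divB Φ B DivB (op Z.base) (↑w⁻¹ : B.obj (op Z.base)) =
      (divB Φ B DivB (op Z.base) (pull B g (unit s)))⁻¹ := by
    apply eq_inv_of_mul_eq_one_right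
    rw [← map_mul, ← hw, Units.mul_inv, map_one]
  have hrel : Z.cls ^ ((1 : ℕ+) : ℕ) * Algebra.GrothendieckGroup.of 1 =
      pullGp Φ g X.cls * divB Φ B DivB (op Z.base) u := by
    rw [PNat.one_coe, pow_one, map_one, mul_one]
    change Z.cls = pullGp Φ g X.cls * divB Φ B DivB (op Z.base) (↑(ut * w⁻¹) : B.obj (op Z.base))
    have E3 : Z.cls * divB Φ B DivB _ (pull B g (unit s)) =
        pullGp Φ g X.cls * divB Φ B DivB _ (unit t) := by
      apply mul_right_cancel (b := Algebra.GrothendieckGroup.of (div t))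
      calc Z.cls * divB Φ B DivB _ (pull B g (unit s)) * Algebra.GrothendieckGroup.of (div t)
          = Z.cls * Algebra.GrothendieckGroup.of (div t) * divB Φ B DivB _ (pull B g (unit s)) := by
            rw [mul_right_comm]
        _ = pullGp Φ (baseMap t) Y.cls * divB Φ B DivB _ (pull B g (unit s)) *
              divB Φ B DivB _ (unit t) := by rw [E1, mul_right_comm]
        _ = pullGp Φ g X.cls * Algebra.GrothendieckGroup.of (div t) * divB Φ B DivB _ (unit t) := by
            rw [E2]
        _ = pullGp Φ g X.cls * divB Φ B DivB _ (unit t) * Algebra.GrothendieckGroup.of (div t) := by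
            rw [mul_right_comm]
    rw [Units.val_mul, hut, map_mul, hinv, ← mul_assoc, ← E3, mul_inv_cancel_right]
  let v₀ : Z ⟶ X := mkHom Z X 1 g 1 u hrel
  haveI : IsIso (baseMap v₀) := by
    change IsIso g
    infer_instance
  haveI : IsIso v₀ := isIso_of hBg v₀ rfl rfl
  refine ⟨asIso v₀, hom_ext ?_ ?_ ?_ ?_⟩
  · change degFr s * 1 = degFr t
    rw [mul_one, hs, ht]
  · change (baseMap t ≫ inv (baseMap s)) ≫ baseMap s = baseMap t
    rw [Category.assoc, IsIso.inv_hom_id, Category.comp_id]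
  · change pull Φ g (div s) * (1 : Φ.obj (op Z.base)) ^ (degFr s : ℕ) = div t
    rw [one_pow, mul_one, hdivt]
  · change pull B g (unit s) * (↑(ut * w⁻¹) : B.obj (op Z.base)) ^ (degFr s : ℕ) = unit t
    rw [hs, PNat.one_coe, pow_one, Units.val_mul, ← hw, mul_comm, Units.inv_mul_cancel_right, hut]

/-! ### Units -/

/-- Two isomorphisms `v, v' : Y ⥲ Z` with the same `Base` differ by an element of `O^×(Y)`:
`v'⁻¹ ∘ v ∈ O^×(Y)` (base-identity, linear). [cite: MochizukiFrdI2008, Thm. 5.2(ii) p.101] -/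
theorem trans_symm_mem_units (v v' : Y ≅ Z) (h : baseMap v.hom = baseMap v'.hom) :
    v ≪≫ v'.symm ∈ units Y := by
  refine ⟨?_, ?_⟩
  · change baseMap (v.hom ≫ v'.inv) = 𝟙 _
    rw [baseMap_comp, h, ← baseMap_comp, Iso.hom_inv_id, baseMap_id]
  · change degFr (v.hom ≫ v'.inv) = 1
    rw [degFr_comp, degFr_eq_one_of_isIso v.hom, degFr_eq_one_of_isIso v'.inv, mul_one]

/-- Target-side version: two isomorphisms `v, v' : Y ⥲ Z` with the same `Base` differ by an element
of `O^×(Z)`: `v' ∘ v⁻¹ ∈ O^×(Z)`. [cite: MochizukiFrdI2008, Thm. 5.2(ii) p.101] -/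
theorem symm_trans_mem_units (v v' : Y ≅ Z) (h : baseMap v.hom = baseMap v'.hom) :
    v.symm ≪≫ v' ∈ units Z := by
  have hinv : baseMap v.inv = baseMap v'.inv := by
    haveI : IsIso (baseMap v.hom) := isIso_baseMap_of_isIso v.hom
    rw [← cancel_epi (baseMap v.hom)]
    conv_lhs => rw [← baseMap_comp, Iso.hom_inv_id, baseMap_id]
    rw [h, ← baseMap_comp, Iso.hom_inv_id, baseMap_id]
  refine ⟨?_, ?_⟩
  · change baseMap (v.inv ≫ v'.hom) = 𝟙 _
    rw [baseMap_comp, hinv, ← baseMap_comp, Iso.inv_hom_id, baseMap_id]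
  · change degFr (v.inv ≫ v'.hom) = 1
    rw [degFr_comp, degFr_eq_one_of_isIso v.inv, degFr_eq_one_of_isIso v'.hom, mul_one]

/-- An element of `O^×(Y)` with trivial rational function `u = 1` is trivial (`Φ` divisorial, so that
`Div = 0` on `O^×`; a morphism is determined by `(deg_Fr, Base, Div, u)`).
[cite: MochizukiFrdI2008, Thm. 5.2(ii) p.101] -/
theorem eq_one_of_mem_units_of_unit_eq_one (hΦd : Objectwise (fun M _ => IsDivisorial M) Φ)
    {w : Aut Y} (hw : w ∈ units Y) (hu : unit w.hom = 1) : w = 1 := by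
  apply Iso.ext
  exact hom_ext hw.2 hw.1 (div_eq_one_of_mem_units (hΦd Y.base).isSharp hw) hu

/-- For `w ∈ O^×(Y)`: `Base(w)^* = id` on `B(Base Y)`. [cite: MochizukiFrdI2008, Thm. 5.2(ii) p.101] -/
theorem pull_baseMap_of_mem_units {w : Aut Y} (hw : w ∈ units Y) (b : B.obj (op Y.base)) :
    pull B (baseMap w.hom) b = b := by
  rw [hw.1, pull_id]

/-! ### The fraction `s' · (s'')⁻¹` under composition -/

section Frac

/-- `u_{v ∘ s}` as a unit, for a linear `v`: `(Base(s)^* u_v) · u_s`.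
[cite: MochizukiFrdI2008, Thm. 5.2(ii) p.101] -/
theorem unitU_comp_of_degFr_eq_one (hB : ∀ b : B.obj (op X.base), IsUnit b) (s : X ⟶ Y) {v : Y ⟶ Z}
    (hv : degFr v = 1) :
    unitU hB (s ≫ v) = (hB (pull B (baseMap s) (unit v))).unit * unitU hB s :=
  Units.ext (by rw [Units.val_mul, coe_unitU, coe_unitU, IsUnit.unit_spec, unit_comp_of_degFr_eq_one s hv])

/-- **Post-composition with a linear morphism does not change the fraction**: for a base-equivalent
pair `s', s'' : X → Y` and a linear `v : Y → Z`, `(v ∘ s') · (v ∘ s'')⁻¹ = s' · (s'')⁻¹` in `B(Base X)`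
(both units of the composites acquire the same factor `Base(s')^* u_v`).
[cite: MochizukiFrdI2008, Thm. 5.2(ii) p.101] -/
theorem frac_comp_of_degFr_eq_one (hB : ∀ b : B.obj (op X.base), IsUnit b) (s' s'' : X ⟶ Y)
    (hb : baseMap s' = baseMap s'') {v : Y ⟶ Z} (hv : degFr v = 1) :
    frac hB (s' ≫ v) (s'' ≫ v) = frac hB s' s'' := by
  rw [frac, frac, unitU_comp_of_degFr_eq_one hB s' hv, unitU_comp_of_degFr_eq_one hB s'' hv]
  simp_rw [hb]
  rw [mul_div_mul_left_eq_div]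

/-- **Pre-composition transports the fraction**: for `s', s'' : X → Y` of the same Frobenius degree and
any `v : Z → X`, `(s' ∘ v) · (s'' ∘ v)⁻¹ = Base(v)^* (s' · (s'')⁻¹)` in `B(Base Z)`.
[cite: MochizukiFrdI2008, Thm. 5.2(ii) p.101] -/
theorem coe_frac_comp_left (hBX : ∀ b : B.obj (op X.base), IsUnit b)
    (hBZ : ∀ b : B.obj (op Z.base), IsUnit b) (v : Z ⟶ X) (s' s'' : X ⟶ Y)
    (hd : degFr s' = degFr s'') :
    (frac hBZ (v ≫ s') (v ≫ s'') : B.obj (op Z.base)) = pull B (baseMap v) (frac hBX s' s'' : B.obj _) := by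
  have h1 : (frac hBZ (v ≫ s') (v ≫ s'') : B.obj (op Z.base)) * unit (v ≫ s'') = unit (v ≫ s') := by
    rw [frac, div_eq_mul_inv, Units.val_mul, coe_unitU, mul_assoc, ← coe_unitU hBZ (v ≫ s''),
      Units.inv_mul, mul_one]
  have h2 : pull B (baseMap v) (frac hBX s' s'' : B.obj _) * unit (v ≫ s'') = unit (v ≫ s') := by
    rw [unit_comp_pull, unit_comp_pull, hd, ← mul_assoc, ← map_mul, frac, div_eq_mul_inv, Units.val_mul,
      coe_unitU, mul_assoc, ← coe_unitU hBX s'', Units.inv_mul, mul_one]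
  obtain ⟨c, hc⟩ := hBZ (unit (v ≫ s''))
  rw [← hc] at h1 h2
  exact (Units.mul_left_inj c).mp (h1.trans h2.symm)

/-- **Inserting a unit on the target side divides the fraction by its rational function**: for
`w ∈ O^×(Y)`, `s' · (w ∘ s'')⁻¹ · (Base(s'')^* u_w) = s' · (s'')⁻¹`.
[cite: MochizukiFrdI2008, Thm. 5.2(ii) p.101] -/
theorem frac_comp_unit_mul (hB : ∀ b : B.obj (op X.base), IsUnit b) (s' s'' : X ⟶ Y) {w : Aut Y}
    (hw : w ∈ units Y) :
    frac hB s' (s'' ≫ w.hom) * (hB (pull B (baseMap s'') (unit w.hom))).unit = frac hB s' s'' := by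
  rw [frac, frac, unitU_comp_of_degFr_eq_one hB s'' hw.2, mul_comm _ (unitU hB s''), ← div_div,
    div_mul_cancel]

/-- `u_{s'' ∘ w}` as a unit, for `w ∈ O^×(X)`: `u_{s''} · u_w ^ deg_Fr(s'')` (`Base(w) = id`).
[cite: MochizukiFrdI2008, Thm. 5.2(ii) p.101] -/
theorem unitU_unit_comp (hB : ∀ b : B.obj (op X.base), IsUnit b) {w : Aut X} (hw : w ∈ units X)
    (s'' : X ⟶ Y) : unitU hB (w.hom ≫ s'') = unitU hB s'' * unitU hB w.hom ^ (degFr s'' : ℕ) :=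
  Units.ext (by
    rw [Units.val_mul, Units.val_pow_eq_pow_val, coe_unitU, coe_unitU, coe_unitU, unit_comp_pull,
      pull_baseMap_of_mem_units hw])

/-- **Inserting a unit on the source side divides the fraction by a power of its rational function**:
for `w ∈ O^×(X)`, `s' · (s'' ∘ w)⁻¹ · u_w ^ deg_Fr(s'') = s' · (s'')⁻¹`.
[cite: MochizukiFrdI2008, Thm. 5.2(ii) p.101] -/
theorem frac_unit_comp_mul (hB : ∀ b : B.obj (op X.base), IsUnit b) (s' s'' : X ⟶ Y) {w : Aut X}
    (hw : w ∈ units X) :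
    frac hB s' (w.hom ≫ s'') * unitU hB w.hom ^ (degFr s'' : ℕ) = frac hB s' s'' := by
  rw [frac, frac, unitU_unit_comp hB hw s'', ← div_div, div_mul_cancel]

end Frac

end ModelFrobenioid

end Literature.AlgebraicGeometry.Frobenioids

end
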